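import Literature.AlgebraicGeometry.Deformation.SmoothSchemeLiftObstructionCechCocycleIdentity
import Literature.AlgebraicGeometry.Morphisms.CechModuleH2Refinement
import HarnessLib

/-!
# The Čech obstruction 2-cochain restricts along a refinement by basic opens
# (Hartshorne, *Deformation Theory*, proof of Thm. 10.2 (a): independence of the cover — the restriction half)

Layer `Literature/AlgebraicGeometry/Deformation`, namespace `Literature.AlgebraicGeometry.Deformation` (THEOREMS only: no
definition, no instance, no notation, no named fact).  Sequel of ★ F2 `SmoothSchemeLiftObstructionCechCocycle` /
`…CechCocycleIdentity` (the obstruction cochain `o ∈ Č²(𝔘, 𝒯_{X/k})` of lifted transition automorphisms `ψ j l` of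
`A' ⊗_k Γ(U j ∩ U l)` on a principal affine cover `𝔘 = (U, b)` of the closed fibre, its cocycle identity and its change under
a change of lifts) in the SAME currency (the `variable`s and the REPRESENTATION clause «`u (1 ⊗ c) = 1 ⊗ c + t ⊗ θ(dc)`» are
those of F2 verbatim), and of ★ `Morphisms/CechModuleH2Refinement` (the refinement map `ρ_τ : Č²(𝔘, M) → Č²(𝔚, M)` of a map
of families of opens `τ : 𝔚 → 𝔘`, `W s ⊆ U (τ s)`, Görtz–Wedhorn II (21.16)).

THE PRINT. [Hartshorne2010, Thm. 10.2 (a), proof, p. 81] computes the obstruction `δ₃ ∈ H²(X₀, T⁰ ⊗ J)` on one open affine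
cover and uses it as a class of `X₀`; [Hartshorne1977, III Ex. 4.4 / Lemma 4.4 background; GortzWedhorn2023, Lemma 21.72] the
Čech class is transported to a refinement by `ρ_τ`.  This file is the bookkeeping of that transport for the obstruction
cochain of F2: along a refinement `𝔚` of `𝔘` BY BASIC OPENS OF THE MEMBERS OF `𝔘` (`W s = D(a s)`, `a s ∈ Γ(U (τ s))` — the
shape in which refinements are constructed, ★ `Morphisms/PrincipalAffineCoverRefinement`, and the one that makes every
`W s ∩ W t` a principal open of the affine `U (τ s) ∩ U (τ t)`, so that ★ F1's localisation devices restrict the `ψ`'s),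

* §1 the cover lemmas (`W s ∩ W t`, `W s ∩ W t ∩ W r` are principal in `U (τ s) ∩ U (τ t)`, in
  `U (τ s) ∩ U (τ t) ∩ U (τ r)`, in `W s`, in `W s ∩ W t`; a basic-open refinement of a principal affine cover is a principal
  affine cover);
* §2 maps out of `A' ⊗_k Γ(D(f))` are determined on `A' ⊗_k Γ(V)` (★ F1 `algHom_ext_of_comp_map` in scheme currency), and
  «restrictions on the refinement restrict the restrictions»;
* §3 **the restricted lifts** `ψ^W s t` on `A' ⊗_k Γ(W s ∩ W t)` exist, are unique, and again induce the identity modulo `𝔫'`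
  (`exists_algEquiv_refine`, `algEquiv_refine_unique`);
* the sequel `SmoothSchemeLiftObstructionRefineCochain` concludes: the refined cochain `ρ_τ o` of any obstruction cochain
  `o` of `ψ` IS an obstruction cochain of the restricted lifts `ψ^W` (F2's characterisation on `𝔚`, exactly), so every
  obstruction cochain of `ψ^W` equals `ρ_τ o` and differs from it by a Čech coboundary.

Cell `hodgecm-mathlib`, F-11 road (a′) «abelian varieties are unobstructed», slot (4) rel₂ of the (iv-5) assembly
`GAP2_of_slots` (COVER INDEPENDENCE of the obstruction class): these two files are the restriction-along-`τ` half; the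
same-cover half is the `f := 𝟙` case of the functoriality file.  HC_CM is proved only modulo the 7 printed citations until
rung 0 closes — nothing here bears on a summit statement.

## References
* [Hartshorne2010] R. Hartshorne, *Deformation Theory*, GTM 257, Springer (2010): Thm. 10.2 (a) and its proof (p. 81),
  Remark 10.1.1 (p. 80).
* [GortzWedhorn2023] U. Görtz, T. Wedhorn, *Algebraic Geometry II*, Springer Spektrum (2023): (21.16) Def. 21.71 and
  Lemma 21.72 (p. 262) (refinement maps on Čech cochains; independence of the refinement).
* [Hartshorne1977] R. Hartshorne, *Algebraic Geometry*, GTM 52 (1977): II Prop. 2.2 / Ex. 2.16 (a) (basic opens of affine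
  opens), III §4 p. 218 (Čech cochains on an affine cover).
-/

noncomputable section

-- `TopCat.Presheaf`/`TopCat.Sheaf` are not reducible (as in Mathlib's `AlgebraicGeometry/Modules`).
set_option backward.isDefEq.respectTransparency false

open CategoryTheory AlgebraicGeometry Opposite TopologicalSpace
open scoped TensorProduct

universe u

namespace Literature.AlgebraicGeometry.Deformation

open Literature.AlgebraicGeometry.HodgeTheory Literature.AlgebraicGeometry.Modules
  Literature.AlgebraicGeometry.Motives Literature.AlgebraicGeometry.Morphisms SmoothAffineDeformation

variable {k : Type u} [Field k] {X : Over (Spec (CommRingCat.of k))}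
  [instΓ : ∀ W : X.left.Opens, Algebra k Γ(X.left, W)]
  (halg : ∀ (W : X.left.Opens) (s : k), algebraMap k Γ(X.left, W) s = (constToPresheaf X).app (op W) s)
  {A' : Type u} [CommRing A'] [Algebra k A']
  {ι : Type u} (U : ι → X.left.affineOpens) (b : (j l : ι) → Γ(X.left, (U j).1))
  (hb : ∀ j l, (U j).1 ⊓ (U l).1 = X.left.basicOpen (b j l))
  {κ : Type u} (W : κ → X.left.Opens) (τ : κ → ι) (hτ : ∀ s, W s ≤ (U (τ s)).1)
  (a : (s : κ) → Γ(X.left, (U (τ s)).1)) (hWa : ∀ s, W s = X.left.basicOpen (a s))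

/-! ## §1 The cover lemmas: a refinement by basic opens of the members of a principal affine cover -/

section Cover

omit instΓ in
include hWa in
/-- For `V ⊆ U (τ s)`, `V ∩ W s = D(a s|_V)` is a principal open of `V`.
[cite: Hartshorne1977, II Prop. 2.2 (b) (basic opens, p. 71)] -/
theorem inf_refine_eq_basicOpen_map {V : X.left.Opens} {s : κ} (hV : V ≤ (U (τ s)).1) :
    V ⊓ W s = X.left.basicOpen (X.left.presheaf.map (homOfLE hV).op (a s)) := by
  rw [Scheme.basicOpen_res, ← hWa]

omit instΓ in
include hWa in
/-- `W s` is affine (a basic open of the affine `U (τ s)`). [cite: Hartshorne1977, II Prop. 2.2 (b) (p. 71)] -/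
theorem isAffineOpen_refine (s : κ) : IsAffineOpen (W s) := by
  rw [hWa]
  exact (U (τ s)).2.basicOpen _

omit instΓ in
include hτ hWa in
/-- **`W s ∩ W t` is principal in the affine `U (τ s) ∩ U (τ t)`**: `W s ∩ W t = D(a s| · a t|)`.
[cite: Hartshorne1977, III §4 p. 218 (intersections of the affine cover)] -/
theorem refine_inf₂_eq_basicOpen (s t : κ) :
    W s ⊓ W t = X.left.basicOpen
      (X.left.presheaf.map (homOfLE (inf_le_left : (U (τ s)).1 ⊓ (U (τ t)).1 ≤ (U (τ s)).1)).op (a s) *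
        X.left.presheaf.map (homOfLE (inf_le_right : (U (τ s)).1 ⊓ (U (τ t)).1 ≤ (U (τ t)).1)).op (a t)) := by
  have hV : W s ⊓ W t ≤ (U (τ s)).1 ⊓ (U (τ t)).1 := inf_le_inf (hτ s) (hτ t)
  rw [Scheme.basicOpen_mul, Scheme.basicOpen_res, Scheme.basicOpen_res, ← hWa s, ← hWa t]
  apply le_antisymm
  · exact le_inf (le_inf hV inf_le_left) (le_inf hV inf_le_right)
  · exact le_inf (inf_le_left.trans inf_le_right) (inf_le_right.trans inf_le_right)

omit instΓ in
include hb hτ hWa in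
/-- `W s ∩ W t` is affine. [cite: Hartshorne1977, III §4 p. 218 (intersections of the affine cover)] -/
theorem isAffineOpen_refine_inf₂ (s t : κ) : IsAffineOpen (W s ⊓ W t) := by
  rw [refine_inf₂_eq_basicOpen U W τ hτ a hWa s t]
  exact (isAffineOpen_inf₂ U b hb (τ s) (τ t)).basicOpen _

omit instΓ in
include hτ hWa in
/-- **`W s ∩ W t ∩ W r` is principal in the affine `U (τ s) ∩ U (τ t) ∩ U (τ r)`**: it is `D(a s| · a t| · a r|)`.
[cite: Hartshorne1977, III §4 p. 218 (intersections of the affine cover)] -/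
theorem refine_inf₃_eq_basicOpen (s t r : κ) :
    W s ⊓ W t ⊓ W r = X.left.basicOpen
      (X.left.presheaf.map (homOfLE (inf_le_left.trans inf_le_left :
          (U (τ s)).1 ⊓ (U (τ t)).1 ⊓ (U (τ r)).1 ≤ (U (τ s)).1)).op (a s) *
        X.left.presheaf.map (homOfLE (inf_le_left.trans inf_le_right :
          (U (τ s)).1 ⊓ (U (τ t)).1 ⊓ (U (τ r)).1 ≤ (U (τ t)).1)).op (a t) *
        X.left.presheaf.map (homOfLE (inf_le_right :
          (U (τ s)).1 ⊓ (U (τ t)).1 ⊓ (U (τ r)).1 ≤ (U (τ r)).1)).op (a r)) := by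
  have h3 : W s ⊓ W t ⊓ W r ≤ (U (τ s)).1 ⊓ (U (τ t)).1 ⊓ (U (τ r)).1 :=
    inf_le_inf (inf_le_inf (hτ s) (hτ t)) (hτ r)
  rw [Scheme.basicOpen_mul, Scheme.basicOpen_mul, Scheme.basicOpen_res, Scheme.basicOpen_res, Scheme.basicOpen_res,
    ← hWa s, ← hWa t, ← hWa r]
  apply le_antisymm
  · exact le_inf (le_inf (le_inf h3 (inf_le_left.trans inf_le_left)) (le_inf h3 (inf_le_left.trans inf_le_right)))
      (le_inf h3 inf_le_right)
  · exact le_inf (le_inf (inf_le_left.trans (inf_le_left.trans inf_le_right))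
      (inf_le_left.trans (inf_le_right.trans inf_le_right))) (inf_le_right.trans inf_le_right)

omit instΓ in
include hb hτ hWa in
/-- `W s ∩ W t ∩ W r` is affine. [cite: Hartshorne1977, III §4 p. 218 (intersections of the affine cover)] -/
theorem isAffineOpen_refine_inf₃ (s t r : κ) : IsAffineOpen (W s ⊓ W t ⊓ W r) := by
  rw [refine_inf₃_eq_basicOpen U W τ hτ a hWa s t r]
  exact (isAffineOpen_inf₃ U b hb (τ s) (τ t) (τ r)).basicOpen _

omit instΓ in
include hb hτ hWa in
/-- **`W s ∩ W t` is principal in `W s`** (through the principal open `W s ∩ U (τ t) = D(b|)` of `W s`; a basic open of a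
basic open of an affine open is basic). [cite: Hartshorne1977, II Prop. 2.2 (b) (p. 71)] -/
theorem exists_refine_inf₂_eq_basicOpen₁ (s t : κ) : ∃ g : Γ(X.left, W s), W s ⊓ W t = X.left.basicOpen g := by
  have hWs : IsAffineOpen (W s) := isAffineOpen_refine U W τ a hWa s
  have e1 : W s ⊓ (U (τ t)).1 = X.left.basicOpen (X.left.presheaf.map (homOfLE (hτ s)).op (b (τ s) (τ t))) :=
    inf_eq_basicOpen_map U b hb (hτ s) (τ t)
  have hO : X.left.basicOpen (X.left.presheaf.map (homOfLE (hτ s)).op (b (τ s) (τ t))) ≤ (U (τ t)).1 :=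
    e1.ge.trans inf_le_right
  have e2 := inf_refine_eq_basicOpen_map U W τ a hWa hO
  obtain ⟨g, hg⟩ := hWs.basicOpen_basicOpen_is_basicOpen _ (X.left.presheaf.map (homOfLE hO).op (a t))
  refine ⟨g, ?_⟩
  rw [hg, ← e2, ← e1, inf_assoc, inf_eq_right.2 (hτ t)]

omit instΓ in
include hb hτ hWa in
/-- **A refinement by basic opens of a principal affine cover is a principal affine cover**: `W s ∩ W t = D(c s t)`,
`c s t ∈ Γ(W s)`. [cite: Hartshorne1977, II Ex. 2.16 (a)] [cite: Hartshorne1977, III §4 p. 218] -/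
theorem exists_refine_principal : ∃ c : (s t : κ) → Γ(X.left, W s), ∀ s t, W s ⊓ W t = X.left.basicOpen (c s t) := by
  have h := fun s t => exists_refine_inf₂_eq_basicOpen₁ U b hb W τ hτ a hWa s t
  choose c hc using h
  exact ⟨c, hc⟩

omit instΓ in
include hb hτ hWa in
/-- **`W s ∩ W t ∩ W r` is principal in `W s ∩ W t`** (through the principal open `W s ∩ W t ∩ U (τ r)` of the affine
`W s ∩ W t`). [cite: Hartshorne1977, II Prop. 2.2 (b) (p. 71)] [cite: Hartshorne1977, III §4 p. 218] -/
theorem exists_refine_inf₃_eq_basicOpen₂ (s t r : κ) :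
    ∃ g : Γ(X.left, W s ⊓ W t), W s ⊓ W t ⊓ W r = X.left.basicOpen g := by
  have hW2 : IsAffineOpen (W s ⊓ W t) := isAffineOpen_refine_inf₂ U b hb W τ hτ a hWa s t
  have hV : W s ⊓ W t ≤ (U (τ s)).1 := inf_le_left.trans (hτ s)
  have e1 : W s ⊓ W t ⊓ (U (τ r)).1 = X.left.basicOpen (X.left.presheaf.map (homOfLE hV).op (b (τ s) (τ r))) :=
    inf_eq_basicOpen_map U b hb hV (τ r)
  have hO : X.left.basicOpen (X.left.presheaf.map (homOfLE hV).op (b (τ s) (τ r))) ≤ (U (τ r)).1 :=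
    e1.ge.trans inf_le_right
  have e2 := inf_refine_eq_basicOpen_map U W τ a hWa hO
  obtain ⟨g, hg⟩ := hW2.basicOpen_basicOpen_is_basicOpen _ (X.left.presheaf.map (homOfLE hO).op (a r))
  refine ⟨g, ?_⟩
  rw [hg, ← e2, ← e1, inf_assoc (W s ⊓ W t), inf_eq_right.2 (hτ r)]

omit instΓ in
/-- **The refined cochain of the tangent sheaf, componentwise**: `(ρ_τ o) s t r = o (τ s) (τ t) (τ r)|_{W s ∩ W t ∩ W r}` as a
restricted morphism `Ω¹|_{W³} → 𝒪|_{W³}` (the sections of `𝒯 = 𝓗om(Ω¹, 𝒪)` restrict by `restrictHom`).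
[cite: GortzWedhorn2023, (21.16) Def. 21.71 (p. 262)] [cite: Hartshorne1977, II.5 (sheaf Hom, p. 109)] -/
theorem cechMRefineC2_tangentSheaf_apply (o : CechMC2 X.hom (tangentSheaf X) (fun j => (U j).1)) (s t r : κ) :
    cechMRefineC2 X.hom (tangentSheaf X) (fun j => (U j).1) W τ hτ o s t r =
      restrictHom (homOfLE (inf_le_inf (inf_le_inf (hτ s) (hτ t)) (hτ r))) (o (τ s) (τ t) (τ r)) :=
  rfl

end Cover

/-! ## §2 Maps out of `A' ⊗_k Γ(D(f))`; restrictions on the refinement restrict the restrictions -/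

section Ext

omit instΓ in
/-- **An `A'`-algebra map out of `A' ⊗_k Γ(D(f))` is determined by its composite with the base change from `A' ⊗_k Γ(V)`**
(`V` affine, `D(f) ⊆ V`; ★ F1 `algHom_ext_of_comp_map`: `Γ(D(f)) = Γ(V)_f`).
[cite: Hartshorne2010, Thm. 10.2 (proof), p. 81 («restricting to `U_{ijk}`»)] [cite: Hartshorne1977, II Prop. 2.2 (b) (p. 71)] -/
theorem algHom_ext_of_comp_baseChangeMap [instΓ : ∀ W : X.left.Opens, Algebra k Γ(X.left, W)] {V V' : X.left.Opens}
    (hV : IsAffineOpen V) (f : Γ(X.left, V)) (hV' : V' = X.left.basicOpen f) (h : V' ≤ V)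
    {Φ : A' ⊗[k] Γ(X.left, V) →ₐ[A'] A' ⊗[k] Γ(X.left, V')}
    (hΦ : ∀ a' x, Φ (a' ⊗ₜ x) = a' ⊗ₜ X.left.presheaf.map (homOfLE h).op x)
    {C : Type*} [CommRing C] [Algebra A' C] [Algebra k C] [IsScalarTower k A' C]
    {F G : A' ⊗[k] Γ(X.left, V') →ₐ[A'] C} (hFG : ∀ x, F (Φ x) = G (Φ x)) : F = G := by
  subst hV'
  letI alg : Algebra Γ(X.left, V) Γ(X.left, X.left.basicOpen f) := (X.left.presheaf.map (homOfLE h).op).hom.toAlgebra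
  haveI : IsLocalization.Away f Γ(X.left, X.left.basicOpen f) := hV.isLocalization_basicOpen f
  refine algHom_ext_of_comp_map (Bs := Γ(X.left, X.left.basicOpen f)) (Submonoid.powers f) fun x => ?_
  have e1 : ((1 : A') ⊗ₜ[k] algebraMap Γ(X.left, V) Γ(X.left, X.left.basicOpen f) x : A' ⊗[k] _) =
      Φ ((1 : A') ⊗ₜ x) := by
    rw [hΦ]
    rfl
  rw [e1]
  exact hFG _

include halg in
/-- **Restrictions on the refinement restrict the restrictions**: `V` affine, `V₃ = D(g) ⊆ V`, `O ⊆ V`, `O₃ ⊆ V₃ ∩ O`;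
if `ρ` restricts `u` to `V₃`, `u_O` restricts `u` to `O` and `σ` restricts `u_O` to `O₃`, then `σ` restricts `ρ` along
`V₃ → O₃` (both `σ ∘ Φ` and `Φ ∘ ρ` restrict `u` along `V → O₃`, and maps out of `A' ⊗_k Γ(V₃)` are determined on
`A' ⊗_k Γ(V)`). [cite: Hartshorne2010, Thm. 10.2 (proof), p. 81 («restricting to `U_{ijk}`»)] -/
theorem restrict_compat_of_refine {V V₃ O O₃ : X.left.Opens} (hV : IsAffineOpen V) (g : Γ(X.left, V))
    (hV₃ : V₃ = X.left.basicOpen g) (h₃ : V₃ ≤ V) (hO : O ≤ V) (hO₃ : O₃ ≤ V₃) (hO₃' : O₃ ≤ O)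
    (u : A' ⊗[k] Γ(X.left, V) ≃ₐ[A'] A' ⊗[k] Γ(X.left, V))
    {Φ₃ : A' ⊗[k] Γ(X.left, V) →ₐ[A'] A' ⊗[k] Γ(X.left, V₃)}
    (hΦ₃ : ∀ a' x, Φ₃ (a' ⊗ₜ x) = a' ⊗ₜ X.left.presheaf.map (homOfLE h₃).op x)
    {ΦO : A' ⊗[k] Γ(X.left, V) →ₐ[A'] A' ⊗[k] Γ(X.left, O)}
    (hΦO : ∀ a' x, ΦO (a' ⊗ₜ x) = a' ⊗ₜ X.left.presheaf.map (homOfLE hO).op x)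
    {Φ₄ : A' ⊗[k] Γ(X.left, V₃) →ₐ[A'] A' ⊗[k] Γ(X.left, O₃)}
    (hΦ₄ : ∀ a' x, Φ₄ (a' ⊗ₜ x) = a' ⊗ₜ X.left.presheaf.map (homOfLE hO₃).op x)
    {ΦO₃ : A' ⊗[k] Γ(X.left, O) →ₐ[A'] A' ⊗[k] Γ(X.left, O₃)}
    (hΦO₃ : ∀ a' x, ΦO₃ (a' ⊗ₜ x) = a' ⊗ₜ X.left.presheaf.map (homOfLE hO₃').op x)
    {ρ : A' ⊗[k] Γ(X.left, V₃) ≃ₐ[A'] A' ⊗[k] Γ(X.left, V₃)} (hρ : ∀ x, ρ (Φ₃ x) = Φ₃ (u x))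
    {uO : A' ⊗[k] Γ(X.left, O) ≃ₐ[A'] A' ⊗[k] Γ(X.left, O)} (huO : ∀ x, uO (ΦO x) = ΦO (u x))
    {σ : A' ⊗[k] Γ(X.left, O₃) ≃ₐ[A'] A' ⊗[k] Γ(X.left, O₃)} (hσ : ∀ y, σ (ΦO₃ y) = ΦO₃ (uO y)) :
    ∀ y, σ (Φ₄ y) = Φ₄ (ρ y) := by
  -- the base change `V → O₃` (both routes)
  obtain ⟨Φ, hΦ⟩ := exists_baseChangeMap (A' := A') halg V O₃ (hO₃'.trans hO)
  have key : (σ : A' ⊗[k] Γ(X.left, O₃) →ₐ[A'] A' ⊗[k] Γ(X.left, O₃)).comp Φ₄ =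
      Φ₄.comp (ρ : A' ⊗[k] Γ(X.left, V₃) →ₐ[A'] A' ⊗[k] Γ(X.left, V₃)) :=
    algHom_ext_of_comp_baseChangeMap hV g hV₃ h₃ hΦ₃ fun x => by
      rw [AlgHom.comp_apply, AlgHom.comp_apply, AlgEquiv.coe_toAlgHom, AlgEquiv.coe_toAlgHom,
        baseChangeMap_comp_apply h₃ hO₃ hΦ₃ hΦ₄ hΦ, ← baseChangeMap_comp_apply hO hO₃' hΦO hΦO₃ hΦ, hσ, huO,
        baseChangeMap_comp_apply hO hO₃' hΦO hΦO₃ hΦ, hρ, baseChangeMap_comp_apply h₃ hO₃ hΦ₃ hΦ₄ hΦ]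
  intro y
  have hy := AlgHom.congr_fun key y
  simpa only [AlgHom.comp_apply, AlgEquiv.coe_toAlgHom] using hy

end Ext

/-! ## §3 The restricted lifts on the refinement -/

section Lifts

variable (𝔫' : Ideal A')

include halg hb hWa in
/-- **The lifted transition automorphisms restrict to the refinement**: for `ψ j l` on `A' ⊗_k Γ(U j ∩ U l)` inducing the
identity modulo the nilpotent `𝔫'`, there are `A'`-automorphisms `ψ^W s t` of `A' ⊗_k Γ(W s ∩ W t)` compatible with
`ψ (τ s) (τ t)` through the base change `A' ⊗_k Γ(U (τ s) ∩ U (τ t)) → A' ⊗_k Γ(W s ∩ W t)` (for EVERY characterised base-change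
map), again `≡ 1 (mod 𝔫')` (★ F1/F2 `exists_algEquiv_restrict` on the principal open `W s ∩ W t = D(a s|·a t|)`).
[cite: Hartshorne2010, Thm. 10.2 (proof), p. 81 («restricting to `U_{ijk}`»)] -/
theorem exists_algEquiv_refine (h𝔫 : IsNilpotent 𝔫')
    (ψ : (j l : ι) → A' ⊗[k] Γ(X.left, (U j).1 ⊓ (U l).1) ≃ₐ[A'] A' ⊗[k] Γ(X.left, (U j).1 ⊓ (U l).1))
    (hψ : ∀ j l x, ψ j l x - x ∈ 𝔫' • (⊤ : Submodule A' (A' ⊗[k] Γ(X.left, (U j).1 ⊓ (U l).1)))) :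
    ∃ ψW : (s t : κ) → A' ⊗[k] Γ(X.left, W s ⊓ W t) ≃ₐ[A'] A' ⊗[k] Γ(X.left, W s ⊓ W t),
      (∀ (s t : κ) (Φ : A' ⊗[k] Γ(X.left, (U (τ s)).1 ⊓ (U (τ t)).1) →ₐ[A'] A' ⊗[k] Γ(X.left, W s ⊓ W t)),
        (∀ a' x, Φ (a' ⊗ₜ x) = a' ⊗ₜ X.left.presheaf.map (homOfLE (inf_le_inf (hτ s) (hτ t))).op x) →
        ∀ x, ψW s t (Φ x) = Φ (ψ (τ s) (τ t) x)) ∧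
      ∀ s t y, ψW s t y - y ∈ 𝔫' • (⊤ : Submodule A' (A' ⊗[k] Γ(X.left, W s ⊓ W t))) := by
  have hΦ₀ := fun s t => exists_baseChangeMap (A' := A') halg ((U (τ s)).1 ⊓ (U (τ t)).1) (W s ⊓ W t)
    (inf_le_inf (hτ s) (hτ t))
  choose Φ₀ hΦ₀ using hΦ₀
  have hex := fun s t => exists_algEquiv_restrict halg 𝔫' (isAffineOpen_inf₂ U b hb (τ s) (τ t)) _
    (refine_inf₂_eq_basicOpen U W τ hτ a hWa s t) (inf_le_inf (hτ s) (hτ t)) h𝔫 (ψ (τ s) (τ t)) (hψ _ _) (hΦ₀ s t)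
  choose ψW hψW hψW𝔫 using hex
  refine ⟨ψW, fun s t Φ hΦ => ?_, hψW𝔫⟩
  have eΦ : Φ = Φ₀ s t := Algebra.TensorProduct.ext' fun a' x => by rw [hΦ, hΦ₀]
  subst eΦ
  exact hψW s t

include halg hb hτ hWa in
/-- **The restricted lift is unique**: two `A'`-automorphisms of `A' ⊗_k Γ(W s ∩ W t)` compatible with the same automorphism
of `A' ⊗_k Γ(U (τ s) ∩ U (τ t))` through the base change coincide (★ F2 `algEquiv_restrict_unique`).
[cite: Hartshorne2010, Thm. 10.2 (proof), p. 81] -/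
theorem algEquiv_refine_unique (s t : κ)
    (u : A' ⊗[k] Γ(X.left, (U (τ s)).1 ⊓ (U (τ t)).1) ≃ₐ[A'] A' ⊗[k] Γ(X.left, (U (τ s)).1 ⊓ (U (τ t)).1))
    {Φ : A' ⊗[k] Γ(X.left, (U (τ s)).1 ⊓ (U (τ t)).1) →ₐ[A'] A' ⊗[k] Γ(X.left, W s ⊓ W t)}
    (hΦ : ∀ a' x, Φ (a' ⊗ₜ x) = a' ⊗ₜ X.left.presheaf.map (homOfLE (inf_le_inf (hτ s) (hτ t))).op x)
    {uW uW' : A' ⊗[k] Γ(X.left, W s ⊓ W t) ≃ₐ[A'] A' ⊗[k] Γ(X.left, W s ⊓ W t)}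
    (huW : ∀ x, uW (Φ x) = Φ (u x)) (huW' : ∀ x, uW' (Φ x) = Φ (u x)) : uW = uW' :=
  algEquiv_restrict_unique halg (isAffineOpen_inf₂ U b hb (τ s) (τ t)) _ (refine_inf₂_eq_basicOpen U W τ hτ a hWa s t)
    (inf_le_inf (hτ s) (hτ t)) u hΦ huW huW'

end Lifts

end Literature.AlgebraicGeometry.Deformation

end
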